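import Literature.Claims.NS.ClayVariants
import Mathlib.Analysis.SpecialFunctions.Pow.Real
import Mathlib.MeasureTheory.Integral.IntervalIntegral.Basic
import HarnessLib

/-!
# Claim skeleton (D-0090 NS-CLAIMS, C104): Vidal Silvente, «A Dual Demonstration of Navier–Stokes Global
# Regularity via Logical–Fractal Resonance» (Zenodo 17315183 v6, 2025)

Typed skeleton of E. Vidal Silvente, *A Dual Demonstration of Navier–Stokes Global Regularity via
Logical–Fractal Resonance*, **Zenodo record 17315183** (concept 15396333, version 6 = last, 2025-10-10; PDF
front page «June 2025»; 17 pp., PDF page = printed page) — the TEXT OF RECORD for row C104 (cell ruling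
ns-claims-lead-1 RULINGS v1.29t (1), 2026-08-27; Authorea doi:10.22541/au.175103947.75907817/v3 is the
census identifier, not fetchable from the hub), bib `Silvente2025`; PDF + `pages/pNNN.txt` + renders in
`run/shared/lean/pub/ns-claims/sources/Silvente2025/Zenodo-17315183/` (LOCATORS.md by ns-claims-lit-1 g6).
UNREFEREED CLAIM under adjudication (T3 QUICK tranche) — NOTHING in this file asserts a step: the paper's
statements are `def … : Prop`; the only theorems are kernel relations (compositions by pure logic and the
Clay link). `p.N l.M` = page N, line M of `pages/pNNN.txt`. The theorem environments of the PDF print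
WITHOUT numbers; they are cited by their bracketed titles («[Fractal Energy Inequality]», …).

## The claimed statement (verbatim)

§1 p.3 l.2–11: «The three-dimensional incompressible Navier–Stokes equations ∂ₜu + (u·∇)u − νΔu + ∇p = 0,
∇·u = 0, govern fluid flow phenomena but lack a rigorous proof of global-in-time smooth solutions for
arbitrary smooth initial data. This question is formalized as one of the Clay Mathematics Institute's
Millennium Prize Problems: to show that, given divergence-free u₀ ∈ H^s(ℝ³) with s > 3/2, there exists
a unique global smooth solution u(t) for all t ≥ 0.»; l.19–21 «No prior framework has combined … to close
the global regularity gap. In this work we fill that gap …»; §8 p.13 l.9–10 «We have established global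
regularity for the three-dimensional incompressible Navier–Stokes equations through two complementary yet
intrinsically unified perspectives.»; §8.1 p.14 l.2–4 «… we prove that no finite-time singularity can
form, even without smallness assumptions on initial data.» Direction: REGULARITY, (A)-shaped (ℝ³, f ≡ 0,
ν > 0, all t ≥ 0). RENDERING: the statement the text identifies with the Millennium problem, typed at
Clay's data class (4) — `ClaimedTheorem` = «∀ ν > 0, every smooth divergence-free datum of class (4) has a
Clay-(A)-sense solution» = `ClayVariants.clayR3.Regularity` token for token (`claimedTheorem_iff_clayA` is
`Iff.rfl`). The paper's own data sentence «u₀ ∈ H^s, s > 3/2» is WIDER than (4) and «unique» is an extra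
conjunct; neither is typed (recorded in the Clay delta; typing them could only strengthen the claim).

## Clay delta (reference `Literature.Claims.NS.ClayVariants`)

Nearest (A). Δ1 ℝ³ =; Δ2 ν > 0 =; Δ3 f ≡ 0 =; Δ4 data: print «H^s(ℝ³), s > 3/2» ⊇ Clay (4) — typed AT (4)
(no obstruction; the wider class is not used); Δ5/Δ6 «unique global smooth solution» — uniqueness extra,
energy bound (7) not printed (the Clay sense is what the text invokes, §1 l.5); Δ7 all t ≥ 0 =. So: Δ none
on the face of the statement. The SUBSTANTIVE restriction lives inside the proof: the only closed bound is a
SMALL-DATA one (p.10 l.68–69 «if E(0) < ε», App. A p.17 «under a smallness condition in the fractal norm»,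
p.16 «provided E(0) < 1/(C²T²)») — typed as `ClaimedSmall` (what Steps 1–2 would deliver: Δ4 SMALL DATA
in the weighted dyadic norm), not as a delta of the headline (C35 `VasquezCampos2024` pattern).

## Architecture of the printed argument and ORDERED STEP INDEX

GRAIN. The «analytical route» (§6 pp.9–10, §9.4 pp.15–16, App. A p.17, §8.1 p.14) passes information
through two scalar functions of time attached to a solution: the weighted dyadic energy
`E(t) = Σ_k w_k²‖u_k(t)‖²_{L²}` and dissipation `D(t) = Σ_k w_k²‖∇u_k(t)‖²_{L²}` (§6.4 p.10 l.23–38;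
`u_k = M_k u` Littlewood–Paley pieces, weights `w_k ∼ 2^{αk}`). Everything the route asserts about
Navier–Stokes is (i) that along the flow `E′ + 2νD ≤ C E^{3/2}` with a universal `C` ([Weighted Energy
Inequality] §9.4 p.15 l.38–58 = [Fractal Energy Inequality] §6.5 p.10 l.62–67) and (ii) that boundedness of
`E` on `[0,∞)` is global regularity (p.10 l.68–69 «E(t) remains finite for all t ≥ 0, ensuring global
regularity»; §7.3 p.12 l.29–32; p.11 l.15–17). These field-level inputs are bundled, C74-style, in the
hypothesis-structure `Route C ν u₀ E D` (what the scalar steps USE; not itself a refutation target — its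
`bridge` field is an implication whose premise is the output of Step 2 / Step 3b), and the SCALAR
INFERENCES the text performs on `E` are typed as printed, as statements about nonnegative differentiable
functions (the print states them in exactly that form: p.16 l.1–5 «Suppose E(t) satisfies: … Then»,
p.11 l.9–15 «Suppose the evolution satisfies the refined inequality: … Then E(t) remains uniformly
bounded»). `E^{3/2}` is typed as `E·√E` (equal for `E ≥ 0`, which is a hypothesis throughout). The
constant `C > 0` («universal constant C > 0 independent of initial data», p.10 l.67) is a parameter of
every step; the claim needs the steps for SOME `C > 0`.

* Step 1 = `Step_1 C` (`RouteExists`) — §6.1–§6.5 pp.9–10 + §9.4 [Weighted Energy Inequality] p.15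
  l.38–58 (proof: «Differentiate E(t) and use the dyadic equation with Lemma 9.2 … Cauchy–Schwarz and the
  commutator bound», resting on [Commutator Estimate] §9.2 p.15 l.4–21 `‖[M_j, u·∇]u_k‖ ≤ C w_j w_k ‖u_j‖‖u_k‖`
  and the weights §9.3 p.15) with the bridge sentence p.10 l.68–69 / §7.3 p.12: for every `ν > 0` and every
  Clay datum there are `E, D` with `Route C ν u₀ E D`. Flag: SUSPICIOUS at the NS level (a dyadic energy
  inequality with weights GROWING like `2^{αk}` and a data-independent constant), but not the QUICK locator;
  averaged-equation test applicable (only LP/Bernstein/energy structure is used) — refuter's call.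
* Step 2 = `Step_2 C` (`SmallDataClosure`) — the small-data GLOBAL closure, printed three times: p.10
  l.68–69 «Moreover, if E(0) < ε for sufficiently small ε > 0, then E(t) remains finite for all t ≥ 0»;
  §9.4 [Resonant Grönwall Estimate] p.16 l.1–16 «Suppose E(t) satisfies E′ + 2νD ≤ CE^{3/2}, E(0) < ϵ. Then
  E(t) ≤ E(0)/(1 − Ct√E(0))², remains finite for all t provided E(0) < 1/(C²T²). The resonance-induced
  decay of w_k extends this globally.»; App. A p.17 l.2–12 «… which remains finite for all t provided
  E(0) < ϵ for some universal ϵ > 0. This proves global regularity under a smallness condition in the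
  fractal norm.» Typed as printed on p.16/p.17: a universal `ε > 0` such that every admissible pair with the
  law and `E(0) < ε` has `E` bounded on `[0,∞)`. Flag: KNOWN-FALSE PATTERN at this grain (the comparison
  function `E(t) = E(0)(1 − ½Ct√E(0))^{−2}`, and the polynomial `E(t) = (ε/2)(1 + at)²`, `a = ½C√(ε/2)`,
  `D ≡ 0`, obey the law for every `E(0) > 0`; the printed bound is itself finite only for `t < 1/(C√E(0))`
  — the print's own proviso `E(0) < 1/(C²T²)` is `T`-dependent); the honest local half is `Step_2loc`
  (TRUE-type, not consumed by any all-time conclusion). Recorded for the refuter, NOT asserted. NS-level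
  caveat for the referee: «small data in a (sub)critical norm ⇒ global smooth solution» is TRUE by other
  means (Fujita–Kato; tree `hasGlobalFujitaKatoSolution_of_le_fkDelta`) — a charitable retype at the
  NS level may survive as a theorem while rescuing nothing of the all-data claim.
* Step 3a = `Step_3a C` (`RefinedLawHolds`, IMPLICIT) — [Resonant Grönwall Inequality] p.11 l.9–14
  «Suppose the evolution satisfies the refined inequality E′ + 2νD ≤ C E^{3/2}/(1 + log(1 + I[E](t)))»,
  `I[E](t) = ∫₀ᵗ E(s)/(1 + log(1 + E(s))) ds` (p.11 l.4–8): the hypothesis of the all-data step, introduced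
  by «Suppose» and DERIVED NOWHERE (§6.5 delivers the unrefined law; Theorem 4.2 p.9 and §9.6 p.16 are
  commutator bounds; §9.4 p.15 proves the unrefined law only). Typed as the existence, for every `ν > 0`
  and Clay datum, of a route pair obeying the refined inequality. Flag: UNPRINTED (gap candidate).
* Step 3b = `Step_3b C` (`ResonantGronwall`) — [Resonant Grönwall Inequality] p.11 l.15–17 «Then E(t)
  remains uniformly bounded for all t ≥ 0, even without assuming smallness of E(0). In particular, the
  nonlinear term on the right-hand side decays asymptotically due to the growth of I[E](t), precluding
  blow-up»; §8.1 p.14 l.2–4. Typed as printed: every admissible pair obeying the refined inequality has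
  `E` bounded on `[0,∞)`. Flag: KNOWN-FALSE PATTERN at this grain (`E(t) = (1 + at)²`, `D ≡ 0`, small
  `a > 0`: the logarithmic denominator grows like `log t`, the right side like `t³`). NOT asserted.
* The «constructive route» §7 pp.11–12 / §9.5 p.16: local contraction on `[0,T]` for small `T` (classical,
  TRUE-type, not typed) and §7.3 p.12 l.29–32 «By the analytical energy bounds of Section ??, the iterates
  satisfy uniform a priori estimates on each interval of length T. Patching these local solutions extends
  u(t) for all t ≥ 0» — the uniform bound IS the output of Step 2 / Step 3b («Section ??» unresolved as
  printed), so §7 has no independent all-data content and composes through the same joint; recorded here,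
  not typed (§8.2 p.14 l.9 «bypasses technical dependencies on energy bounds» notwithstanding, §7.3 cites them).

COMPOSITION — PROVED: `claim_of_steps : Step_3a C → Step_3b C → ClaimedTheorem` (the all-data
analytical route: refined law along the flow ⇒ `E` bounded ⇒ bridge); `claimedSmall_of_step_2 :
Step_2 C → ClaimedSmall C` (the small-data route delivers only `ClaimedSmall`, Δ4); `step_1_of_step_3a`.
The paper's logic composes AS PRINTED through Step 3a/3b; the pre-registered locator candidates are
Step 2 (print order) and Step 3a/3b (dependency order of the all-data conclusion) — adjudicated by
refuter/referee, not here.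

WHAT THIS IS NOT: not a claim about NS regularity or blow-up; not a claim about any author beyond the
typed locator.
-/

noncomputable section

open Set Function Filter MeasureTheory
open scoped ContDiff Topology

namespace Literature.Claims.NS.Silvente2025

open Literature.Analysis.FluidPDE

/-! ### Vocabulary -/

/-- A Clay (A) datum: smooth, divergence free, rapid decay (4) — the class at which the headline is typed
(§1 p.3 «arbitrary smooth initial data» / the Millennium problem; the print's own «u₀ ∈ H^s, s > 3/2» is
wider). [cite: Silvente2025, §1 p.3 l.2–11] -/
def IsClayDatum (u₀ : EuclideanSpace ℝ (Fin 3) → EuclideanSpace ℝ (Fin 3)) : Prop :=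
  ContDiff ℝ ∞ u₀ ∧ NSWave0.IsDivFree u₀ ∧ HasRapidSpatialDecay u₀

/-- An ADMISSIBLE scalar pair `(E, D)` — what the text's energy/dissipation functions (§6.4 p.10 l.23–38)
are as functions of time: `E` differentiable (the print differentiates it, p.15 l.56), `E, D ≥ 0` on
`[0,∞)`. [cite: Silvente2025, §6.4 p.10 l.23–38] -/
structure Admissible (E D : ℝ → ℝ) : Prop where
  /-- `E` is differentiable (so that `E′ = deriv E`) -/
  diff : Differentiable ℝ E
  /-- `E ≥ 0` on `[0,∞)` -/
  nonneg_E : ∀ t : ℝ, 0 ≤ t → 0 ≤ E t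
  /-- `D ≥ 0` on `[0,∞)` -/
  nonneg_D : ∀ t : ℝ, 0 ≤ t → 0 ≤ D t

/-- The printed energy law [Fractal Energy Inequality] p.10 l.62–67 = [Weighted Energy Inequality] §9.4
p.15 l.51–55: `d/dt E(t) + 2νD(t) ≤ C E(t)^{3/2}` for `t ≥ 0` (`E^{3/2}` written `E·√E`, equal for `E ≥ 0`).
[cite: Silvente2025, [Fractal Energy Inequality] p.10 l.62–67] -/
def LawIneq (C ν : ℝ) (E D : ℝ → ℝ) : Prop :=
  ∀ t : ℝ, 0 ≤ t → deriv E t + 2 * ν * D t ≤ C * (E t * Real.sqrt (E t))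

/-- The «integral resonance-modulated damping function» p.11 l.4–8:
`I[E](t) = ∫₀ᵗ E(s)/(1 + log(1 + E(s))) ds`. [cite: Silvente2025, [Resonant Grönwall Inequality] p.11 l.4–8] -/
def dampI (E : ℝ → ℝ) (t : ℝ) : ℝ :=
  ∫ s in (0 : ℝ)..t, E s / (1 + Real.log (1 + E s))

/-- The «refined inequality» p.11 l.9–14:
`d/dt E(t) + 2νD(t) ≤ C E(t)^{3/2}/(1 + log(1 + I[E](t)))` for `t ≥ 0`.
[cite: Silvente2025, [Resonant Grönwall Inequality] p.11 l.9–14] -/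
def RefinedIneq (C ν : ℝ) (E D : ℝ → ℝ) : Prop :=
  ∀ t : ℝ, 0 ≤ t → deriv E t + 2 * ν * D t ≤ C * (E t * Real.sqrt (E t)) / (1 + Real.log (1 + dampI E t))

/-- `E` bounded on `[0,∞)` («E(t) remains finite / uniformly bounded for all t ≥ 0», p.10 l.68, p.11 l.15).
[cite: Silvente2025, p.10 l.68–69; p.11 l.15] -/
def BoundedOn0 (E : ℝ → ℝ) : Prop :=
  ∃ M : ℝ, ∀ t : ℝ, 0 ≤ t → E t ≤ M

/-- **What the analytical route USES of §6–§9 about Navier–Stokes**, for a viscosity `ν`, a datum `u₀`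
and a scalar pair `(E, D)` (the weighted dyadic energy and dissipation of «the» solution, §6.4 p.10):
admissibility; the energy law with the universal constant `C` ([Weighted Energy Inequality] p.15, proof
l.56–58 via [Commutator Estimate] §9.2 p.15 and the weights §9.3); and the BRIDGE the text asserts — if
`E` stays bounded on `[0,∞)` then the datum has a global smooth (Clay-(A)-sense) solution (p.10 l.68–69
«E(t) remains finite for all t ≥ 0, ensuring global regularity»; §7.3 p.12 l.29–32 «uniform a priori
estimates … Patching these local solutions extends u(t) for all t ≥ 0. Standard parabolic regularity
theory then implies u(t) is smooth»). A hypothesis-structure: it records the printed architecture; it is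
not itself a refutation target. [cite: Silvente2025, §6.1–6.5 pp.9–10; §9.4 p.15; §7.3 p.12] -/
structure Route (C ν : ℝ) (u₀ : EuclideanSpace ℝ (Fin 3) → EuclideanSpace ℝ (Fin 3)) (E D : ℝ → ℝ) :
    Prop where
  /-- `E` differentiable, `E, D ≥ 0` on `[0,∞)` -/
  adm : Admissible E D
  /-- [Weighted Energy Inequality] p.15 / [Fractal Energy Inequality] p.10 along the flow -/
  law : LawIneq C ν E D
  /-- bounded weighted energy on `[0,∞)` ⇒ a Clay-(A)-sense solution from `u₀` (p.10 l.68–69, §7.3 p.12) -/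
  bridge : BoundedOn0 E → ClayVariants.clayR3.Solvable ν 0 u₀

/-! ### The claimed theorem (§1 p.3; §8 p.13–14) -/

/-- **HEADLINE** (§1 p.3 l.5–11 with l.19–21 «we fill that gap», §8 p.13 l.9–10 «We have established
global regularity for the three-dimensional incompressible Navier–Stokes equations», §8.1 p.14 «even
without smallness assumptions on initial data»), at Clay's data class: every `ν > 0` and every smooth
divergence-free datum of class (4) admit a Clay-(A)-sense solution on `ℝ³ × [0,∞)`.
[claim: Silvente2025, status: disputed] -/
def ClaimedTheorem : Prop :=
  ∀ ν : ℝ, 0 < ν → ∀ u₀ : EuclideanSpace ℝ (Fin 3) → EuclideanSpace ℝ (Fin 3), ContDiff ℝ ∞ u₀ →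
    NSWave0.IsDivFree u₀ → HasRapidSpatialDecay u₀ → ClayVariants.clayR3.Solvable ν 0 u₀

/-- The headline IS Clay (A), token for token. [cite: FeffermanClay2006, statement (A), CMI offprint p. 2] -/
theorem claimedTheorem_iff_clayA : ClaimedTheorem ↔ ClayVariants.clayR3.Regularity :=
  Iff.rfl

/-- **Clay link.** [cite: FeffermanClay2006, statement (A), CMI offprint p. 2] -/
theorem clay_of_claimed (h : ClaimedTheorem) : ClayVariants.clayR3.Regularity :=
  claimedTheorem_iff_clayA.1 h

/-- **What the small-data route delivers** (p.10 l.68–69, App. A p.17 l.11–12 «This proves global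
regularity under a smallness condition in the fractal norm»): for SOME universal `ε > 0`, every datum whose
route energy starts below `ε` has a Clay-sense solution — Δ4 SMALL DATA (in the weighted dyadic norm), not
the headline. [cite: Silvente2025, App. A p.17 l.2–12] -/
def ClaimedSmall (C : ℝ) : Prop :=
  ∃ ε : ℝ, 0 < ε ∧ ∀ ν : ℝ, 0 < ν → ∀ u₀ : EuclideanSpace ℝ (Fin 3) → EuclideanSpace ℝ (Fin 3),
    IsClayDatum u₀ → ∀ E D : ℝ → ℝ, Route C ν u₀ E D → E 0 < ε → ClayVariants.clayR3.Solvable ν 0 u₀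

/-! ### The paper's steps (no assertion) -/

/-- **Step 1 — the route exists** (§6.1–§6.5 pp.9–10, §9.4 [Weighted Energy Inequality] p.15 l.38–58,
bridge p.10 l.68–69 / §7.3 p.12): for every `ν > 0` and every Clay datum there is an admissible pair
`(E, D)` — the weighted dyadic energy and dissipation of the flow — obeying `E′ + 2νD ≤ C E^{3/2}` and
whose boundedness on `[0,∞)` yields a Clay-sense solution. Hypothesis-structure of the printed
architecture (`Route`); SUSPICIOUS at the NS level, not the QUICK locator. [claim: Silvente2025, status: disputed] -/
def Step_1 (C : ℝ) : Prop :=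
  ∀ ν : ℝ, 0 < ν → ∀ u₀ : EuclideanSpace ℝ (Fin 3) → EuclideanSpace ℝ (Fin 3), IsClayDatum u₀ →
    ∃ E D : ℝ → ℝ, Route C ν u₀ E D

/-- **Step 2 — the small-data GLOBAL closure** (p.10 l.68–69 «if E(0) < ε for sufficiently small ε > 0,
then E(t) remains finite for all t ≥ 0»; [Resonant Grönwall Estimate] p.16 l.1–16 incl. «The
resonance-induced decay of w_k extends this globally»; App. A p.17 l.2–12 «remains finite for all t
provided E(0) < ϵ for some universal ϵ > 0»), typed as printed on p.16/p.17 — a statement about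
admissible pairs obeying the law: a universal `ε > 0` below which `E` stays bounded on `[0,∞)`.
KNOWN-FALSE PATTERN at this grain (module docstring); NS-level caveat recorded there.
[claim: Silvente2025, status: disputed] -/
def Step_2 (C : ℝ) : Prop :=
  ∃ ε : ℝ, 0 < ε ∧ ∀ ν : ℝ, 0 < ν → ∀ E D : ℝ → ℝ, Admissible E D → LawIneq C ν E D →
    E 0 < ε → BoundedOn0 E

/-- **Step 2, local half** ([Resonant Grönwall Estimate] p.16 l.6–14, the displayed bound with its own
proviso): under the law, `E(t) ≤ E(0)/(1 − Ct√E(0))²` for `0 ≤ t ≤ T` whenever `0 < E(0) < 1/(C²T²)` — a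
HORIZON-DEPENDENT bound (TRUE-type by ODE comparison, `(E^{−1/2})′ ≥ −C/2`; the print's constant `C` in
place of `C/2` only weakens it). Typed to record exactly what p.16 establishes before the sentence «extends
this globally»; consumed by no all-time conclusion. [claim: Silvente2025, status: disputed] -/
def Step_2loc (C : ℝ) : Prop :=
  ∀ ν : ℝ, 0 < ν → ∀ E D : ℝ → ℝ, Admissible E D → LawIneq C ν E D →
    ∀ T : ℝ, 0 < T → 0 < E 0 → E 0 < 1 / (C ^ 2 * T ^ 2) →
      ∀ t : ℝ, 0 ≤ t → t ≤ T → E t ≤ E 0 / (1 - C * t * Real.sqrt (E 0)) ^ 2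

/-- **Step 3a — IMPLICIT: the refined law holds along the flow** ([Resonant Grönwall Inequality] p.11
l.9–14 «Suppose the evolution satisfies the refined inequality …»): for every `ν > 0` and every Clay
datum, the route pair obeys `E′ + 2νD ≤ C E^{3/2}/(1 + log(1 + I[E]))`. Introduced by «Suppose» and
derived nowhere in the text (§6.5/§9.4 give the unrefined law only) — the undischarged hypothesis of the
all-data conclusion; UNPRINTED (gap candidate). [claim: Silvente2025, status: disputed] -/
def Step_3a (C : ℝ) : Prop :=
  ∀ ν : ℝ, 0 < ν → ∀ u₀ : EuclideanSpace ℝ (Fin 3) → EuclideanSpace ℝ (Fin 3), IsClayDatum u₀ →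
    ∃ E D : ℝ → ℝ, Route C ν u₀ E D ∧ RefinedIneq C ν E D

/-- **Step 3b — the «Resonant Grönwall» inference** (p.11 l.15–17 «Then E(t) remains uniformly bounded
for all t ≥ 0, even without assuming smallness of E(0) … precluding blow-up and establishing global
regularity»; §8.1 p.14 l.2–4), typed as printed: every admissible pair obeying the refined inequality has
`E` bounded on `[0,∞)`. KNOWN-FALSE PATTERN at this grain (module docstring). [claim: Silvente2025, status: disputed] -/
def Step_3b (C : ℝ) : Prop :=
  ∀ ν : ℝ, 0 < ν → ∀ E D : ℝ → ℝ, Admissible E D → RefinedIneq C ν E D → BoundedOn0 E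

/-! ### Kernel relations (pure logic; nothing about Navier–Stokes is proved here) -/

/-- The refined route contains the plain route. [cite: Silvente2025, p.10–11] -/
theorem step_1_of_step_3a {C : ℝ} (h : Step_3a C) : Step_1 C := by
  intro ν hν u₀ hu₀
  obtain ⟨E, D, hR, -⟩ := h ν hν u₀ hu₀
  exact ⟨E, D, hR⟩

/-- **COMPOSITION of the all-data analytical route, as printed** (§6.5 p.10 → [Resonant Grönwall
Inequality] p.11 → bridge p.10 l.68–69 / §7.3 p.12 → §8 p.13): the refined law along the flow (Step 3a)
and the resonant Grönwall inference (Step 3b) give the headline. PROVED — the paper's logic composes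
through this joint; which of Step 2 / 3a / 3b fails first is the refuter's and referee's finding.
[cite: Silvente2025, §6.5 p.10; p.11 l.3–22; §8 p.13 l.9–10] -/
theorem claim_of_steps {C : ℝ} (h3a : Step_3a C) (h3b : Step_3b C) : ClaimedTheorem := by
  intro ν hν u₀ hu₀ hdiv hdec
  obtain ⟨E, D, hR, hRef⟩ := h3a ν hν u₀ ⟨hu₀, hdiv, hdec⟩
  exact hR.bridge (h3b ν hν E D hR.adm hRef)

/-- Hence Step 3a ∧ Step 3b would give Clay (A). [cite: FeffermanClay2006, statement (A), CMI offprint p. 2] -/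
theorem clayA_of_steps {C : ℝ} (h3a : Step_3a C) (h3b : Step_3b C) : ClayVariants.clayR3.Regularity :=
  clay_of_claimed (claim_of_steps h3a h3b)

/-- **COMPOSITION of the small-data route** (p.10 l.62–69; §9.4 pp.15–16; App. A p.17): the law along
the flow and the small-data closure give solvability ONLY for data whose weighted energy starts below the
universal `ε` — `ClaimedSmall`, not the headline (Δ4). PROVED. [cite: Silvente2025, App. A p.17 l.2–12] -/
theorem claimedSmall_of_step_2 {C : ℝ} (h2 : Step_2 C) : ClaimedSmall C := by
  obtain ⟨ε, hε, h⟩ := h2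
  refine ⟨ε, hε, fun ν hν u₀ _ E D hR hE0 => hR.bridge (h ν hν E D hR.adm hR.law hE0)⟩

end Literature.Claims.NS.Silvente2025
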